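import Summits.HodgeConjecture.HodgeConjecture.Theorems.HeckePrymWeilHeckePrymAnchorsOfKAction
import HarnessLib

/-!
# `HeckePrymAnchors` from the route item `DeligneWeilFamily` (stmt-HodgeConjecture-16866) — closure for line `Sketch`, v20

Line `Sketch` of crux `HeckePrymAnchors` (item stmt-HodgeConjecture-14496, route HeckePrymWeil),
continuation lead c14. Up to v19 the crux was closed modulo ONE named fact of the tree (any one of
`HodgeTheory.weilFamilyReach_hyperbolic`, `deligne1982_weilFamily_kAction`, `_globalAction`,
`_levelStructure`, `weilFamily_hyperbolic_weilSystem_reach`; closures p125617, `…OfKAction`,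
p120402, `…OfLevelStructure`). On 2026-08-16 (21:17Z) the route-choice planner PROMOTED the common
external leaf of all these closures to a ROUTE ITEM, stmt-HodgeConjecture-16866 `DeligneWeilFamily`:
the GLOBAL-CLASS rendering of `deligne1982_weilFamily_kAction` — Deligne's abelian scheme with
`𝒪_K`-action through `X` ([Deligne1982HodgeCycles], proof of Thm. 4.8 pp. 47–51), with the fact's
continuous section `σ` of `FiberClass f (2k)` through `e^{-1*}c` replaced by ONE global class
`W ∈ H^{2k}(𝒳(ℂ); ℂ)` with `W|_{s₁} = e^{-1*}c`, and `IsQuasiProjectiveOver S` inlined; every other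
clause verbatim.

This file certifies, in the tree, that closing that item closes this crux:

* `kAction_of_deligneWeilFamily` — the item's statement (verbatim, fully qualified, as filed on the
  ledger; the Theses decl is not rendered yet) implies `deligne1982_weilFamily_kAction`: take
  `σ := globalSection f (2k) W` (`HodgeTheory/HodgeLocus`: continuous by `continuous_globalSection`,
  `(σ s).pt = s` by `rfl`, `σ s₁ = ⟨s₁, W|_{s₁}⟩ = ⟨s₁, e^{-1*}c⟩` by the `W`-clause);
  `IsQuasiProjectiveOver S` is definitionally the inlined clause.
* `heckePrymAnchors_of_deligneWeilFamily` — hence the crux, by the landed one-fact closure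
  `heckePrymAnchors_of_kAction` (`Theorems/HeckePrymWeilHeckePrymAnchorsOfKAction`).

No `sorry`, no definition, no new axiom. The skeleton v20 (`Cruxes/HeckePrymAnchors/Lines/Sketch.lean`)
registers the item's statement as its one stub `stub_deligneWeilFamily` and concludes the crux by
`HeckePrymAnchors_of := heckePrymAnchors_of_deligneWeilFamily stub_deligneWeilFamily`.
-/

noncomputable section

-- every declaration of this problem lives in `Summit.HodgeConjecture.HodgeConjecture.…` (summit = sub-problem)
set_option linter.dupNamespace false

open CategoryTheory AlgebraicGeometry Limits MonoidalCategory CartesianMonoidalCategory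

namespace Summit.HodgeConjecture.HodgeConjecture.Theorems.HeckePrymWeilLine

open Literature.AlgebraicGeometry Literature.AlgebraicGeometry.Motives Literature.AlgebraicGeometry.HodgeTheory
open Summit.HodgeConjecture.HodgeConjecture.Theses.HeckePrymWeil

/-- **The route item `DeligneWeilFamily` (stmt-HodgeConjecture-16866, global-class rendering) implies
the named fact `deligne1982_weilFamily_kAction`** (continuous-section rendering): the flat section
through `e^{-1*}c` is the global section `s ↦ (s, W|_{𝒳_s})` of the global class `W`
(`globalSection`, continuous in the étalé topology of `R^{2k} f_* ℂ`), and the inlined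
quasi-projectivity clause is `IsQuasiProjectiveOver S` by definition.
[cite: Deligne1982HodgeCycles, proof of Thm. 4.8 (pp. 47–51), clauses (b), (c) and p. 50] -/
theorem kAction_of_deligneWeilFamily (h :
    ∀ p : ℕ, p.Prime → p % 4 = 3 → 7 ≤ p → ∀ (k : ℕ), 1 ≤ k → ∀ (X :
      Literature.AlgebraicGeometry.Motives.AbelianVariety ℂ) (Φ : X ⟶ X), X.dim = 2 * k →
      CategoryTheory.CategoryStruct.comp Φ Φ = -((p : ℤ) • CategoryTheory.CategoryStruct.id X) → ∀ c
      : Literature.AlgebraicGeometry.HodgeTheory.complexBetti X.X (2 * k), c ∈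
      Literature.AlgebraicGeometry.HodgeTheory.weilClassesOf X Φ k p → c ≠ 0 →
      Literature.AlgebraicGeometry.HodgeTheory.IsRationalClass c →
      Literature.AlgebraicGeometry.HodgeTheory.IsOfHodgeType (2 * k) X.X (2 * k) k k c → ∃ (𝒳 S :
      Literature.AlgebraicGeometry.Motives.SchemeOver ℂ) (f : 𝒳 ⟶ S) (g : 𝒳 ⟶ 𝒳) (s₁ s₀ :
      Literature.AlgebraicGeometry.Motives.ComplexPoints S) (e : X.X ≅
      Literature.AlgebraicGeometry.Motives.fiberOver f s₁) (W :
      Literature.AlgebraicGeometry.HodgeTheory.complexBetti 𝒳 (2 * k)),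
      Literature.AlgebraicGeometry.Motives.IsSmoothProjectiveFamily f (2 * k) ∧ (∃ (N : ℕ) (ι : 𝒳 ⟶
      CategoryTheory.MonoidalCategoryStruct.tensorObj
      (Literature.AlgebraicGeometry.Motives.projectiveSpace N ℂ) S),
      AlgebraicGeometry.IsClosedImmersion ι.left ∧ CategoryTheory.CategoryStruct.comp ι
      (CategoryTheory.SemiCartesianMonoidalCategory.snd
      (Literature.AlgebraicGeometry.Motives.projectiveSpace N ℂ) S) = f) ∧ IrreducibleSpace S.left ∧
      AlgebraicGeometry.Smooth S.hom ∧ (∃ (P : Literature.AlgebraicGeometry.Motives.SchemeOver ℂ) (j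
      : S ⟶ P), Literature.AlgebraicGeometry.Motives.IsProjectiveOver P ∧
      AlgebraicGeometry.IsOpenImmersion j.left) ∧ CategoryTheory.CategoryStruct.comp g f = f ∧ (∀ s
      : Literature.AlgebraicGeometry.Motives.ComplexPoints S, ∃ (A' :
      Literature.AlgebraicGeometry.Motives.AbelianVariety ℂ) (φ' : A' ⟶ A') (e' : A'.X ≅
      Literature.AlgebraicGeometry.Motives.fiberOver f s), A'.dim = 2 * k ∧
      CategoryTheory.CategoryStruct.comp φ' φ' = -((p : ℤ) • CategoryTheory.CategoryStruct.id A') ∧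
      CategoryTheory.CategoryStruct.comp (CategoryTheory.CategoryStruct.comp e'.hom
      (Literature.AlgebraicGeometry.Motives.fiberι f s)) g = CategoryTheory.CategoryStruct.comp
      φ'.hom.hom.hom (CategoryTheory.CategoryStruct.comp e'.hom
      (Literature.AlgebraicGeometry.Motives.fiberι f s))) ∧ CategoryTheory.CategoryStruct.comp
      (CategoryTheory.CategoryStruct.comp e.hom (Literature.AlgebraicGeometry.Motives.fiberι f s₁))
      g = CategoryTheory.CategoryStruct.comp Φ.hom.hom.hom (CategoryTheory.CategoryStruct.comp e.hom
      (Literature.AlgebraicGeometry.Motives.fiberι f s₁)) ∧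
      Literature.AlgebraicGeometry.HodgeTheory.complexBetti.map
      (Literature.AlgebraicGeometry.Motives.fiberι f s₁) (2 * k) W =
      Literature.AlgebraicGeometry.HodgeTheory.complexBetti.map e.inv (2 * k) c ∧ ∃ (Y :
      Literature.AlgebraicGeometry.Motives.AbelianVariety ℂ) (Ψ : Y ⟶ Y) (e₀ : Y.X ≅
      Literature.AlgebraicGeometry.Motives.fiberOver f s₀), (∃ (A₁ :
      Literature.AlgebraicGeometry.Motives.AbelianVariety ℂ) (f₁ : Y ⟶ A₁.prod A₁) (g₁ : A₁.prod A₁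
      ⟶ Y) (m : ℕ), A₁.dim = k ∧ Y.dim = 2 * k ∧ CategoryTheory.CategoryStruct.comp Ψ Ψ = -((p : ℤ)
      • CategoryTheory.CategoryStruct.id Y) ∧ 0 < m ∧ CategoryTheory.CategoryStruct.comp f₁ g₁ = m •
      CategoryTheory.CategoryStruct.id Y ∧ AlgebraicGeometry.Flat f₁.hom.hom.hom.left ∧
      CategoryTheory.CategoryStruct.comp g₁ Ψ = CategoryTheory.CategoryStruct.comp
      (Literature.AlgebraicGeometry.Motives.AbelianVariety.prodLift
      (CategoryTheory.CategoryStruct.comp (Literature.AlgebraicGeometry.Motives.AbelianVariety.snd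
      A₁ A₁) (-((p : ℤ) • CategoryTheory.CategoryStruct.id A₁)))
      (Literature.AlgebraicGeometry.Motives.AbelianVariety.fst A₁ A₁)) g₁) ∧
      CategoryTheory.CategoryStruct.comp (CategoryTheory.CategoryStruct.comp e₀.hom
      (Literature.AlgebraicGeometry.Motives.fiberι f s₀)) g = CategoryTheory.CategoryStruct.comp
      Ψ.hom.hom.hom (CategoryTheory.CategoryStruct.comp e₀.hom
      (Literature.AlgebraicGeometry.Motives.fiberι f s₀))) :
    deligne1982_weilFamily_kAction := by
  intro p hp hp4 hp7 k hk X Φ hX hΦ c hc hc0 hrat hH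
  obtain ⟨𝒳, S, f, g, s₁, s₀, e, W, hfam, hemb, hirr, hsm, hSqp, hg, hfib, he, hW, Y, Ψ, e₀, hiso,
    he₀⟩ := h p hp hp4 hp7 k hk X Φ hX hΦ c hc hc0 hrat hH
  refine ⟨𝒳, S, f, g, s₁, s₀, e, globalSection f (2 * k) W, hfam, hemb, hirr, hsm, hSqp, hg, hfib,
    he, continuous_globalSection f (2 * k) W, fun s => rfl, ?_, Y, Ψ, e₀, hiso, he₀⟩
  -- `σ s₁ = ⟨s₁, W|_{𝒳_{s₁}}⟩ = ⟨s₁, e^{-1*} c⟩`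
  change (⟨s₁, complexBetti.map (fiberι f s₁) (2 * k) W⟩ : FiberClass f (2 * k)) = _
  rw [hW]

/-- **`HeckePrymAnchors` from the route item `DeligneWeilFamily` (stmt-HodgeConjecture-16866).**
The crux of route `HeckePrymWeil` follows from the item's statement alone: global-class rendering
⇒ `deligne1982_weilFamily_kAction` (`kAction_of_deligneWeilFamily`) ⇒ the crux by the landed
one-fact closure `heckePrymAnchors_of_kAction` (balanced Weil type of every fibre
`deligne1982_weilFamily_globalAction_of_kAction`, aimed companion surface, Deligne-1968 engine
discharged, isogeny transfer, unbalanced `A` anchors only `0`).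
[cite: Deligne1982HodgeCycles, proof of Thm. 4.8 (pp. 47–52) with Prop. 4.4]
[cite: vanGeemen1994HodgeAV, Lemma 5.2 (4), 5.3–5.11] -/
theorem heckePrymAnchors_of_deligneWeilFamily :
    (∀ p : ℕ, p.Prime → p % 4 = 3 → 7 ≤ p → ∀ (k : ℕ), 1 ≤ k → ∀ (X :
      Literature.AlgebraicGeometry.Motives.AbelianVariety ℂ) (Φ : X ⟶ X), X.dim = 2 * k →
      CategoryTheory.CategoryStruct.comp Φ Φ = -((p : ℤ) • CategoryTheory.CategoryStruct.id X) → ∀ c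
      : Literature.AlgebraicGeometry.HodgeTheory.complexBetti X.X (2 * k), c ∈
      Literature.AlgebraicGeometry.HodgeTheory.weilClassesOf X Φ k p → c ≠ 0 →
      Literature.AlgebraicGeometry.HodgeTheory.IsRationalClass c →
      Literature.AlgebraicGeometry.HodgeTheory.IsOfHodgeType (2 * k) X.X (2 * k) k k c → ∃ (𝒳 S :
      Literature.AlgebraicGeometry.Motives.SchemeOver ℂ) (f : 𝒳 ⟶ S) (g : 𝒳 ⟶ 𝒳) (s₁ s₀ :
      Literature.AlgebraicGeometry.Motives.ComplexPoints S) (e : X.X ≅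
      Literature.AlgebraicGeometry.Motives.fiberOver f s₁) (W :
      Literature.AlgebraicGeometry.HodgeTheory.complexBetti 𝒳 (2 * k)),
      Literature.AlgebraicGeometry.Motives.IsSmoothProjectiveFamily f (2 * k) ∧ (∃ (N : ℕ) (ι : 𝒳 ⟶
      CategoryTheory.MonoidalCategoryStruct.tensorObj
      (Literature.AlgebraicGeometry.Motives.projectiveSpace N ℂ) S),
      AlgebraicGeometry.IsClosedImmersion ι.left ∧ CategoryTheory.CategoryStruct.comp ι
      (CategoryTheory.SemiCartesianMonoidalCategory.snd
      (Literature.AlgebraicGeometry.Motives.projectiveSpace N ℂ) S) = f) ∧ IrreducibleSpace S.left ∧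
      AlgebraicGeometry.Smooth S.hom ∧ (∃ (P : Literature.AlgebraicGeometry.Motives.SchemeOver ℂ) (j
      : S ⟶ P), Literature.AlgebraicGeometry.Motives.IsProjectiveOver P ∧
      AlgebraicGeometry.IsOpenImmersion j.left) ∧ CategoryTheory.CategoryStruct.comp g f = f ∧ (∀ s
      : Literature.AlgebraicGeometry.Motives.ComplexPoints S, ∃ (A' :
      Literature.AlgebraicGeometry.Motives.AbelianVariety ℂ) (φ' : A' ⟶ A') (e' : A'.X ≅
      Literature.AlgebraicGeometry.Motives.fiberOver f s), A'.dim = 2 * k ∧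
      CategoryTheory.CategoryStruct.comp φ' φ' = -((p : ℤ) • CategoryTheory.CategoryStruct.id A') ∧
      CategoryTheory.CategoryStruct.comp (CategoryTheory.CategoryStruct.comp e'.hom
      (Literature.AlgebraicGeometry.Motives.fiberι f s)) g = CategoryTheory.CategoryStruct.comp
      φ'.hom.hom.hom (CategoryTheory.CategoryStruct.comp e'.hom
      (Literature.AlgebraicGeometry.Motives.fiberι f s))) ∧ CategoryTheory.CategoryStruct.comp
      (CategoryTheory.CategoryStruct.comp e.hom (Literature.AlgebraicGeometry.Motives.fiberι f s₁))
      g = CategoryTheory.CategoryStruct.comp Φ.hom.hom.hom (CategoryTheory.CategoryStruct.comp e.hom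
      (Literature.AlgebraicGeometry.Motives.fiberι f s₁)) ∧
      Literature.AlgebraicGeometry.HodgeTheory.complexBetti.map
      (Literature.AlgebraicGeometry.Motives.fiberι f s₁) (2 * k) W =
      Literature.AlgebraicGeometry.HodgeTheory.complexBetti.map e.inv (2 * k) c ∧ ∃ (Y :
      Literature.AlgebraicGeometry.Motives.AbelianVariety ℂ) (Ψ : Y ⟶ Y) (e₀ : Y.X ≅
      Literature.AlgebraicGeometry.Motives.fiberOver f s₀), (∃ (A₁ :
      Literature.AlgebraicGeometry.Motives.AbelianVariety ℂ) (f₁ : Y ⟶ A₁.prod A₁) (g₁ : A₁.prod A₁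
      ⟶ Y) (m : ℕ), A₁.dim = k ∧ Y.dim = 2 * k ∧ CategoryTheory.CategoryStruct.comp Ψ Ψ = -((p : ℤ)
      • CategoryTheory.CategoryStruct.id Y) ∧ 0 < m ∧ CategoryTheory.CategoryStruct.comp f₁ g₁ = m •
      CategoryTheory.CategoryStruct.id Y ∧ AlgebraicGeometry.Flat f₁.hom.hom.hom.left ∧
      CategoryTheory.CategoryStruct.comp g₁ Ψ = CategoryTheory.CategoryStruct.comp
      (Literature.AlgebraicGeometry.Motives.AbelianVariety.prodLift
      (CategoryTheory.CategoryStruct.comp (Literature.AlgebraicGeometry.Motives.AbelianVariety.snd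
      A₁ A₁) (-((p : ℤ) • CategoryTheory.CategoryStruct.id A₁)))
      (Literature.AlgebraicGeometry.Motives.AbelianVariety.fst A₁ A₁)) g₁) ∧
      CategoryTheory.CategoryStruct.comp (CategoryTheory.CategoryStruct.comp e₀.hom
      (Literature.AlgebraicGeometry.Motives.fiberι f s₀)) g = CategoryTheory.CategoryStruct.comp
      Ψ.hom.hom.hom (CategoryTheory.CategoryStruct.comp e₀.hom
      (Literature.AlgebraicGeometry.Motives.fiberι f s₀))) →
    Summit.HodgeConjecture.HodgeConjecture.Theses.HeckePrymWeil.HeckePrymAnchors :=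
  fun h => heckePrymAnchors_of_kAction (kAction_of_deligneWeilFamily h)

end Summit.HodgeConjecture.HodgeConjecture.Theorems.HeckePrymWeilLine

end
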